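import Summits.QuantumFields.QCD.Theorems.SpectralDefectExtinctionChiralDescentSharedChiralItems

/-!
# Strategist p1 (wall-breaker) — DECOMPOSITION of crux `ChiralDescent` (stmt-QuantumFields-17527)
# into the two EXISTING shared items stmt-QuantumFields-18327 / 18328, glue LANDED (p139859).

Children are rendered here exactly as the gate would render them inside the route namespace
(`def <Decl> : Prop := <signature verbatim from the ledger>`), so that signature dedup ATTACHES this
route to the existing items instead of minting near-duplicates, and so that the glue elaborates by `δ`-unfolding.
-/

namespace Summit.QuantumFields.QCD.Theses.SpectralDefectExtinction

/-- child 1 = stmt-QuantumFields-18327 `QuarksAsStableAction.MassContinuation`, verbatim. -/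
def MassContinuation : Prop := ∀ Nf : ℕ, Nf = 2 ∨ Nf = 3 → ∀ (reg : Literature.MathematicalPhysics.QuantumFieldTheory.QCDRegularisation Nf) (M ε : ℝ), reg.HasMassScaling → 0 < ε → (∀ m : Fin Nf → ℝ, (∀ f, M < m f) → ∃ (z shift : Literature.MathematicalPhysics.QuantumFieldTheory.QCDField Nf → ℕ → ℝ) (T : Literature.MathematicalPhysics.QuantumFieldTheory.OSData (Literature.MathematicalPhysics.QuantumFieldTheory.QCDField Nf) 4), Literature.MathematicalPhysics.QuantumFieldTheory.IsQCDAlong (reg.scheme m z shift) T ∧ T.IsNontrivial Literature.MathematicalPhysics.QuantumFieldTheory.QCDField.glue ∧ T.IsNonGaussian Literature.MathematicalPhysics.QuantumFieldTheory.QCDField.glue ∧ (∀ f g : Fin Nf, f ≠ g → T.IsNontrivial (Literature.MathematicalPhysics.QuantumFieldTheory.QCDField.pseudoRe f g)) ∧ ∃ Δ > 0, T.HasMassGap Δ ∧ (reg.scheme m z shift).HasLatticeMassGap Δ) → (∀ m : Fin Nf → ℝ, (∀ f, M < m f) → (reg.scheme m 0 0).HasLatticeMassGap ε) → ∃ δ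 > 0, ∀ m : Fin Nf → ℝ, (∀ f, M - δ < m f) → ∃ (z shift : Literature.MathematicalPhysics.QuantumFieldTheory.QCDField Nf → ℕ → ℝ) (T : Literature.MathematicalPhysics.QuantumFieldTheory.OSData (Literature.MathematicalPhysics.QuantumFieldTheory.QCDField Nf) 4), Literature.MathematicalPhysics.QuantumFieldTheory.IsQCDAlong (reg.scheme m z shift) T ∧ T.IsNontrivial Literature.MathematicalPhysics.QuantumFieldTheory.QCDField.glue ∧ T.IsNonGaussian Literature.MathematicalPhysics.QuantumFieldTheory.QCDField.glue ∧ (∀ f g : Fin Nf, f ≠ g → T.IsNontrivial (Literature.MathematicalPhysics.QuantumFieldTheory.QCDField.pseudoRe f g)) ∧ ∃ Δ > 0, T.HasMassGap Δ ∧ (reg.scheme m z shift).HasLatticeMassGap Δ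

/-- child 2 = stmt-QuantumFields-18328 `QuarksAsStableAction.ChiralTupleGapless`, verbatim. -/
def ChiralTupleGapless : Prop := ∀ Nf : ℕ, Nf = 2 ∨ Nf = 3 → ∀ (reg : Literature.MathematicalPhysics.QuantumFieldTheory.QCDRegularisation Nf) (M : ℝ), reg.HasMassScaling → (∀ m : Fin Nf → ℝ, (∀ f, M < m f) → ∃ (z shift : Literature.MathematicalPhysics.QuantumFieldTheory.QCDField Nf → ℕ → ℝ) (T : Literature.MathematicalPhysics.QuantumFieldTheory.OSData (Literature.MathematicalPhysics.QuantumFieldTheory.QCDField Nf) 4), Literature.MathematicalPhysics.QuantumFieldTheory.IsQCDAlong (reg.scheme m z shift) T ∧ T.IsNontrivial Literature.MathematicalPhysics.QuantumFieldTheory.QCDField.glue ∧ T.IsNonGaussian Literature.MathematicalPhysics.QuantumFieldTheory.QCDField.glue ∧ (∀ f g : Fin Nf, f ≠ g → T.IsNontrivial (Literature.MathematicalPhysics.QuantumFieldTheory.QCDField.pseudoRe f g)) ∧ ∃ Δ > 0, T.HasMassGap Δ ∧ (reg.scheme m z shift).HasLatticeMassGap Δ) → ∃ m₀ : Fin Nf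 → ℝ, ∀ Δ : ℝ, 0 < Δ → ¬ (reg.scheme m₀ 0 0).HasLatticeMassGap Δ

/-- The children ARE the sibling route's decls (definitional equality, by `rfl`). -/
example : MassContinuation = Theses.QuarksAsStableAction.MassContinuation := rfl
example : ChiralTupleGapless = Theses.QuarksAsStableAction.ChiralTupleGapless := rfl

/-- THE SPLIT GLUE `C₁ → C₂ → C`, sorry-free: it is the landed cross-route theorem (p139859) read through the
definitional equalities above. This is the term a prover pastes to close the generated glue item, or that
`--glue-by` names. -/
theorem ChiralDescent_of_subs : MassContinuation → ChiralTupleGapless → ChiralDescent :=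
  _root_.Summit.QuantumFields.QCD.Cruxes.ChiralDescent.InfimumDescent.chiralDescent_of_massContinuation_of_chiralTupleGapless

/-- Same glue with the children named by the sibling route's decls (literally the landed theorem). -/
theorem ChiralDescent_of_subs' :
    Theses.QuarksAsStableAction.MassContinuation → Theses.QuarksAsStableAction.ChiralTupleGapless → ChiralDescent :=
  _root_.Summit.QuantumFields.QCD.Cruxes.ChiralDescent.InfimumDescent.chiralDescent_of_massContinuation_of_chiralTupleGapless

/-- And the whole route then decides the sub-problem from its other two cruxes plus the two children
(the route's own `closes`, fed by the glue). -/
theorem closes_of_subs (hW : WindowExtinction) (hB : ExtinctionBuildsQCD)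
    (h₁ : MassContinuation) (h₂ : ChiralTupleGapless) : _root_.QCD :=
  closes hW hB (ChiralDescent_of_subs h₁ h₂)

end Summit.QuantumFields.QCD.Theses.SpectralDefectExtinction
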